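import Mathlib
import Summits.MatrixMultiplication.MatrixMultiplication.Theses.FidelityWitnesses
import Summits.MatrixMultiplication.MatrixMultiplication.Theorems.FidelityWitnessesFidelityThesisSepMajorantTransfer
import Summits.MatrixMultiplication.MatrixMultiplication.Theorems.FidelityWitnessesFidelityThesisSepMajorantBudgetSplit
import Summits.MatrixMultiplication.MatrixMultiplication.Theorems.FidelityWitnessesFidelityThesisStubFidelityGrowthWindow

/-!
# Line `Sketch` (separable-majorant) for crux `FidelityWitnesses.FidelityThesis` (stmt-MatrixMultiplication-4956) —
# THIN BUDGETS CARRY THE WHOLE STUB: fidelity growth ⟺ fidelity growth at budgets `r < n`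

FIDELITY GROWTH FG(δ′, C): `F(S) ≤ C·r^{3/2−δ′}·N(S)` for all `n, r` and all `S` of rank `≤ r` in the `n × n` format
(`F = |⟨S,⟨n,n,n⟩⟩|²`, `N = ‖S‖²`) — the line's one open registered stub `stub_fidelityGrowth` (∃-form).  Lead a1's budget
split (`stub_fidelityGrowth_iff_dpd_and_smallBudget`, p103097) wrote it as `DiagonalPowerDecay ∧ SmallBudgetGrowth` with
SmallBudgetGrowth = FG restricted to `r < n²`.  This file records the (elementary, but orienting) fact that the restriction is
NO weakening, and that one may restrict much further:

* `fidelityGrowthAt_of_thinBudget` — **FG restricted to THIN budgets `r < n` (fewer products than the matrix side) implies FG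
  at the same `(δ′, C)`**: zero-pad `S` from the `n × n` format into the `m × m` format, `m = n + r + 1 > r` (`fgPad_exists`:
  rank does not increase, overlap with `⟨m,m,m⟩` and mass are unchanged), and read the thin-budget law there.  Padding makes
  every budget thin.
* hence `fidelityGrowth_iff_thinBudget`, `fidelityGrowth_iff_smallBudget` (the `r < n²` version), and the consequences of the
  thin-budget law alone: `diagonalPowerDecay_of_thinBudget` (⇒ crux item stmt-14053), `fidelityThesis_of_thinBudget` (⇒ this
  crux), `thinBudget_window` (⇒ `2 + 4δ′/(3−2δ′) ≤ ω(ℂ)`).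

Reading for the planners.  The n-free profile `M(∞, r) := sup_n M(n, r)` is what FG bounds (`M(n,r)` is non-decreasing in `n`
by padding), and the sup is over formats that dwarf the budget: the open content of the line is ENTIRELY the localisation /
"few products in a huge format" question — does a rank-`r` tensor ever capture more of `⟨n,n,n⟩`, `n ≫ r`, than `C·r^{3/2−δ′}`?
(`r^{3/2}`: never, `fidelity_le_rpow_threeHalves`; `r = 2`: the open support item RankTwoAdditivity says `M(∞,2) = 2`.)  In
particular SmallBudgetGrowth is not a second, possibly easier conjunct next to DPD: it IS the stub, and it implies DPD.
Supports `stmt-MatrixMultiplication-4956` (lead c2); Mathlib + tree theorems only; no definitions.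
-/

namespace Summit.MatrixMultiplication.MatrixMultiplication.Theorems

open scoped BigOperators
open Literature.Computability.AlgebraicComplexity
open Summit.MatrixMultiplication.MatrixMultiplication.Theses.FidelityWitnesses (FidelityThesis DiagonalPowerDecay)

/-- **Thin budgets suffice.** If the growth bound `F ≤ C·r^{3/2−δ′}·N` holds for all rank-`≤ r` tensors of the `n × n`
format whenever `r < n`, then it holds for all `n, r` (same `δ′`, same `C`): pad into the format `n + r + 1`. [folklore] -/
theorem fidelityGrowthAt_of_thinBudget {δ' C : ℝ}
    (hthin : ∀ (n r : ℕ) (S : Fin n × Fin n → Fin n × Fin n → Fin n × Fin n → ℂ), r < n → tensorRank S ≤ r →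
      ‖∑ a, ∑ b, ∑ c, S a b c * matMulTensor ℂ n n n a b c‖ ^ 2 ≤
        C * (r : ℝ) ^ (3 / 2 - δ') * ∑ a, ∑ b, ∑ c, ‖S a b c‖ ^ 2)
    (n r : ℕ) (S : Fin n × Fin n → Fin n × Fin n → Fin n × Fin n → ℂ) (hS : tensorRank S ≤ r) :
    ‖∑ a, ∑ b, ∑ c, S a b c * matMulTensor ℂ n n n a b c‖ ^ 2 ≤
      C * (r : ℝ) ^ (3 / 2 - δ') * ∑ a, ∑ b, ∑ c, ‖S a b c‖ ^ 2 := by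
  obtain ⟨S', hrank, hov, hnorm⟩ := fgPad_exists (show n ≤ n + r + 1 by omega) S
  have h := hthin (n + r + 1) r S' (by omega) (hrank.trans hS)
  rwa [hov, hnorm] at h

/-- **Small budgets suffice** (`r < n²` version, the shape of lead a1's SmallBudgetGrowth). [folklore] -/
theorem fidelityGrowthAt_of_smallBudget {δ' C : ℝ}
    (hsmall : ∀ (n r : ℕ) (S : Fin n × Fin n → Fin n × Fin n → Fin n × Fin n → ℂ), r < n ^ 2 → tensorRank S ≤ r →
      ‖∑ a, ∑ b, ∑ c, S a b c * matMulTensor ℂ n n n a b c‖ ^ 2 ≤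
        C * (r : ℝ) ^ (3 / 2 - δ') * ∑ a, ∑ b, ∑ c, ‖S a b c‖ ^ 2)
    (n r : ℕ) (S : Fin n × Fin n → Fin n × Fin n → Fin n × Fin n → ℂ) (hS : tensorRank S ≤ r) :
    ‖∑ a, ∑ b, ∑ c, S a b c * matMulTensor ℂ n n n a b c‖ ^ 2 ≤
      C * (r : ℝ) ^ (3 / 2 - δ') * ∑ a, ∑ b, ∑ c, ‖S a b c‖ ^ 2 :=
  fidelityGrowthAt_of_thinBudget (fun n r S hr hS => hsmall n r S (lt_of_lt_of_le hr (by nlinarith)) hS) n r S hS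

/-- **FG ⟺ FG at thin budgets `r < n`.** [folklore] -/
theorem fidelityGrowth_iff_thinBudget :
    (∃ δ' : ℝ, 0 < δ' ∧ δ' < 3 / 2 ∧ ∃ C : ℝ, 0 < C ∧
      ∀ (n r : ℕ) (S : Fin n × Fin n → Fin n × Fin n → Fin n × Fin n → ℂ), tensorRank S ≤ r →
        ‖∑ a, ∑ b, ∑ c, S a b c * matMulTensor ℂ n n n a b c‖ ^ 2 ≤
          C * (r : ℝ) ^ (3 / 2 - δ') * ∑ a, ∑ b, ∑ c, ‖S a b c‖ ^ 2) ↔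
    (∃ δ' : ℝ, 0 < δ' ∧ δ' < 3 / 2 ∧ ∃ C : ℝ, 0 < C ∧
      ∀ (n r : ℕ) (S : Fin n × Fin n → Fin n × Fin n → Fin n × Fin n → ℂ), r < n → tensorRank S ≤ r →
        ‖∑ a, ∑ b, ∑ c, S a b c * matMulTensor ℂ n n n a b c‖ ^ 2 ≤
          C * (r : ℝ) ^ (3 / 2 - δ') * ∑ a, ∑ b, ∑ c, ‖S a b c‖ ^ 2) := by
  constructor
  · rintro ⟨δ', h0, h1, C, hC, h⟩
    exact ⟨δ', h0, h1, C, hC, fun n r S _ hS => h n r S hS⟩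
  · rintro ⟨δ', h0, h1, C, hC, h⟩
    exact ⟨δ', h0, h1, C, hC, fidelityGrowthAt_of_thinBudget h⟩

/-- **FG ⟺ FG at small budgets `r < n²`** (lead a1's SmallBudgetGrowth is the whole stub, not a residual). [folklore] -/
theorem fidelityGrowth_iff_smallBudget :
    (∃ δ' : ℝ, 0 < δ' ∧ δ' < 3 / 2 ∧ ∃ C : ℝ, 0 < C ∧
      ∀ (n r : ℕ) (S : Fin n × Fin n → Fin n × Fin n → Fin n × Fin n → ℂ), tensorRank S ≤ r →
        ‖∑ a, ∑ b, ∑ c, S a b c * matMulTensor ℂ n n n a b c‖ ^ 2 ≤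
          C * (r : ℝ) ^ (3 / 2 - δ') * ∑ a, ∑ b, ∑ c, ‖S a b c‖ ^ 2) ↔
    (∃ δ' : ℝ, 0 < δ' ∧ δ' < 3 / 2 ∧ ∃ C : ℝ, 0 < C ∧
      ∀ (n r : ℕ) (S : Fin n × Fin n → Fin n × Fin n → Fin n × Fin n → ℂ), r < n ^ 2 → tensorRank S ≤ r →
        ‖∑ a, ∑ b, ∑ c, S a b c * matMulTensor ℂ n n n a b c‖ ^ 2 ≤
          C * (r : ℝ) ^ (3 / 2 - δ') * ∑ a, ∑ b, ∑ c, ‖S a b c‖ ^ 2) := by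
  constructor
  · rintro ⟨δ', h0, h1, C, hC, h⟩
    exact ⟨δ', h0, h1, C, hC, fun n r S _ hS => h n r S hS⟩
  · rintro ⟨δ', h0, h1, C, hC, h⟩
    exact ⟨δ', h0, h1, C, hC, fidelityGrowthAt_of_smallBudget h⟩

/-- **The thin-budget law alone implies the crux item `DiagonalPowerDecay`** (stmt-MatrixMultiplication-14053). [folklore] -/
theorem diagonalPowerDecay_of_thinBudget
    (h : ∃ δ' : ℝ, 0 < δ' ∧ δ' < 3 / 2 ∧ ∃ C : ℝ, 0 < C ∧
      ∀ (n r : ℕ) (S : Fin n × Fin n → Fin n × Fin n → Fin n × Fin n → ℂ), r < n → tensorRank S ≤ r →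
        ‖∑ a, ∑ b, ∑ c, S a b c * matMulTensor ℂ n n n a b c‖ ^ 2 ≤
          C * (r : ℝ) ^ (3 / 2 - δ') * ∑ a, ∑ b, ∑ c, ‖S a b c‖ ^ 2) :
    DiagonalPowerDecay :=
  diagonalPowerDecay_of_fidelityGrowth (fidelityGrowth_iff_thinBudget.2 h)

/-- **The thin-budget law alone implies the crux `FidelityThesis`** (stmt-MatrixMultiplication-4956). [folklore] -/
theorem fidelityThesis_of_thinBudget
    (h : ∃ δ' : ℝ, 0 < δ' ∧ δ' < 3 / 2 ∧ ∃ C : ℝ, 0 < C ∧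
      ∀ (n r : ℕ) (S : Fin n × Fin n → Fin n × Fin n → Fin n × Fin n → ℂ), r < n → tensorRank S ≤ r →
        ‖∑ a, ∑ b, ∑ c, S a b c * matMulTensor ℂ n n n a b c‖ ^ 2 ≤
          C * (r : ℝ) ^ (3 / 2 - δ') * ∑ a, ∑ b, ∑ c, ‖S a b c‖ ^ 2) :
    FidelityThesis :=
  fidelityThesis_of_fidelityGrowth (fidelityGrowth_iff_thinBudget.2 h)

/-- **Window of the thin-budget law**: at `(δ′, C)` it forces `2 + 4δ′/(3 − 2δ′) ≤ ω(ℂ)`; in particular it is at least the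
crux (`⟺ 2 < ω(ℂ)`) and admits no `δ′ ≥ 0.2358` (`not_fidelityGrowthAt_of_ge`). [folklore] -/
theorem thinBudget_window {δ' C : ℝ} (hδ'1 : δ' < 3 / 2) (hC : 0 < C)
    (hthin : ∀ (n r : ℕ) (S : Fin n × Fin n → Fin n × Fin n → Fin n × Fin n → ℂ), r < n → tensorRank S ≤ r →
      ‖∑ a, ∑ b, ∑ c, S a b c * matMulTensor ℂ n n n a b c‖ ^ 2 ≤
        C * (r : ℝ) ^ (3 / 2 - δ') * ∑ a, ∑ b, ∑ c, ‖S a b c‖ ^ 2) :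
    2 + 4 * δ' / (3 - 2 * δ') ≤ omega ℂ :=
  stub_fidelityGrowthWindow hδ'1 hC (fidelityGrowthAt_of_thinBudget hthin)

end Summit.MatrixMultiplication.MatrixMultiplication.Theorems
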